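import Literature.Computability.AlgebraicComplexity.GenericFormsNonsingular
import Literature.Computability.AlgebraicComplexity.SmoothFormFiniteStabilizer
import HarnessLib

/-!
# Generic forms of degree `≥ 3`: zero annihilator and full-dimensional orbit closure

Two corollaries, filed once, of «generic forms are nonsingular» (`isZariskiGeneric_isNonsingularForm`,
`GenericFormsNonsingular.lean`, val-lit-p4 g5, via projective elimination) and «nonsingular forms of
degree `≥ 3` have `𝔤𝔩(W)_F = 0`» (`glAnn_eq_bot_of_isNonsingularForm`, `SmoothFormFiniteStabilizer.lean`,
val-lit-t14 g5, the `ℂ`-instance of Matsumura–Monsky / Poonen Thm. 2 [Poonen2005]): for `D ≥ 3`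
and `n + 2 ≥ 2` variables, Zariski-generic forms (BI 2017 §2.1 "almost all `w ∈ Sym^D ℂ^m`"
[BurgisserIkenmeyer2017], tree `IsZariskiGeneric`) have

* `isZariskiGeneric_glAnn_eq_bot` — zero annihilator `𝔤𝔩(W)_f = 0` (equivalently, by
  `finite_linStabilizer_iff_glAnn_eq_bot`, a finite stabiliser: a second road to
  `isZariskiGeneric_finite_linStabilizer`, BI 2017 Thm. 2.3 first clause, whose printed proof is
  the Fermat witness + openness);
* `isZariskiGeneric_affineDimension_orbitClosure_eq` — an orbit closure `Δ(f) = \overline{GL·f}` of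
  the full dimension `(n+2)²`.

THEOREMS ONLY, no facts. Honest framing: classical bookkeeping; nothing here bears on VP versus VNP.

## References

* P. Bürgisser, C. Ikenmeyer, *Fundamental invariants of orbit closures*, J. Algebra 477 (2017)
  390–434, §2.1 and Thm. 2.3. [BurgisserIkenmeyer2017]
* B. Poonen, *Varieties without extra automorphisms III: hypersurfaces*, Finite Fields Appl. 11
  (2005) 230–268, Thms. 2–3. [Poonen2005]
-/

noncomputable section

open MvPolynomial

namespace Literature.Computability.AlgebraicComplexity

open _root_.Literature.AlgebraicGeometry.Motives.SmoothHypersurface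

variable {n : ℕ}

/-- **Generic forms of degree `D ≥ 3` have zero annihilator** `𝔤𝔩(W)_f = 0`: generic
nonsingularity (`isZariskiGeneric_isNonsingularForm`) and `glAnn_eq_bot_of_isNonsingularForm`.
Typed vs printed: BI 2017 Thm. 2.3 (first clause) states the finite-STABILISER form («for `D ≥ 3`
and `m ≥ 3` … almost all `w` have finite stabilizer»), equivalent by
`finite_linStabilizer_iff_glAnn_eq_bot`; this is a second proof, not the printed one.
[cite: BurgisserIkenmeyer2017, Thm. 2.3 (first clause)] -/
theorem isZariskiGeneric_glAnn_eq_bot {D : ℕ} (hD : 3 ≤ D) :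
    IsZariskiGeneric D fun f : MvPolynomial (Fin (n + 2)) ℂ => glAnn f = ⊥ :=
  (isZariskiGeneric_isNonsingularForm (n := n) (by omega)).mono fun _ hf h =>
    glAnn_eq_bot_of_isNonsingularForm h hf hD

/-- **Generic forms of degree `D ≥ 3` have a finite stabiliser** — BI 2017 Thm. 2.3, first clause,
re-derived through nonsingularity (the tree's `isZariskiGeneric_finite_linStabilizer` is the proof
of record, by the Fermat witness). [cite: BurgisserIkenmeyer2017, Thm. 2.3 (first clause)] -/
theorem isZariskiGeneric_finite_linStabilizer_of_nonsingular {D : ℕ} (hD : 3 ≤ D) :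
    IsZariskiGeneric D fun f : MvPolynomial (Fin (n + 2)) ℂ => Finite (linStabilizer f) :=
  (isZariskiGeneric_isNonsingularForm (n := n) (by omega)).mono fun _ hf h =>
    finite_linStabilizer_of_isNonsingularForm h hf hD

/-- **Generic orbit closures are full-dimensional**: for `D ≥ 3`, Zariski-generic forms `f` in
`n + 2` variables have `dim Δ(f) = (n+2)²` (`affineDimension_orbitClosure_of_isNonsingularForm`).
[cite: BurgisserIkenmeyer2017, §2.1 ("almost all w"); corollary, not in the source] -/
theorem isZariskiGeneric_affineDimension_orbitClosure_eq {D : ℕ} (hD : 3 ≤ D) :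
    IsZariskiGeneric D fun f : MvPolynomial (Fin (n + 2)) ℂ =>
      affineDimension (formCoeff D '' orbitClosure f) = (n + 2) ^ 2 :=
  (isZariskiGeneric_isNonsingularForm (n := n) (by omega)).mono fun _ hf h =>
    affineDimension_orbitClosure_of_isNonsingularForm h hf hD

end Literature.Computability.AlgebraicComplexity

end
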